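import Summits.BirchSwinnertonDyer.BirchSwinnertonDyer.Theses.UniversalToricDescent
import Summits.BirchSwinnertonDyer.Rank1Residual.GaloisImage.PropagatedConditionCardEP
import HarnessLib

/-!
# Route `UniversalToricDescent` — support leaf `LocalEulerPoincareCharacteristicFact`
# (stmt-BirchSwinnertonDyer-20463): a tree THEOREM, by name

Seat `bsd-potss-kmc`, gen 18 (cell `bsd-potss`; kernel service on route `UniversalToricDescent`,
rev 11). Leaf 3/7 of crux #5's published-fact split: Tate's local Euler–Poincaré characteristic at
every completion `K_v` is the tree theorem
`Summit.BirchSwinnertonDyer.Rank1Residual.GaloisImage.EP.localEulerPoincareCharacteristic_adicCompletion`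
(module `Rank1Residual/GaloisImage/PropagatedConditionCardEP`). HONEST FRAMING: one token; BSD is
not advanced by this.

References: [MilneADT2006] I Thm. 2.8.
-/

set_option linter.dupNamespace false

namespace Summit.BirchSwinnertonDyer.BirchSwinnertonDyer.Theorems

open Summit.BirchSwinnertonDyer.BirchSwinnertonDyer.Theses.UniversalToricDescent

/-- **Leaf `LocalEulerPoincareCharacteristicFact` (item 20463) holds**: Tate's local Euler–Poincaré
characteristic formula at every finite completion of a number field — the tree theorem
`EP.localEulerPoincareCharacteristic_adicCompletion`. [cite: MilneADT2006, I Thm. 2.8] -/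
theorem localEulerPoincareCharacteristicFact_proof : LocalEulerPoincareCharacteristicFact := by
  unfold LocalEulerPoincareCharacteristicFact
  intro K _ _ v
  exact Summit.BirchSwinnertonDyer.Rank1Residual.GaloisImage.EP.localEulerPoincareCharacteristic_adicCompletion
    K v

end Summit.BirchSwinnertonDyer.BirchSwinnertonDyer.Theorems
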